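import Literature.MathematicalPhysics.QuantumFieldTheory.Balaban1983to89.B9Thm313WholeCutLettersGXHAtPinsT

/-!
# `Balaban1983to89.B9Thm313WholeCutLettersAtPinsT` — [B9] Theorem 3.13 (p. 426): the re-cut letters' WHOLE free-class content AT THE OPTION (2) BOND PIN
# `bXH := bHZKG (taxiB U) 1 w` — `Letters313Zc.wGp`, the probe letter `pWE` (the certificate's `hWE`) and the full record `Letters313Zc` from `Letters313Z`
# plus printed-species members ((3.44) ∕ (3.45) ∕ (3.43)₁ for G′ read at the transported class, (3.42)₃ ∕ (3.43)₂ for G₀, steps, identities, pins)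

T. Bałaban, *Propagators for lattice gauge theories in a background field*, Commun. Math. Phys. **99** (1985) 389–434
[`Balaban1985BackgroundPropagators`, "B9"]; [4] = T. Bałaban, *Propagators and renormalization transformations for lattice gauge
theories. II*, Commun. Math. Phys. **96** (1984) 223–250 [`Balaban1984PropagatorsII`].

statement-level skeleton of published theorems with citation tags; proofs where landed; nothing here is a claim about the
Yang–Mills mass gap

THE PRINTED LOCI.  [B9] (3.42)–(3.45) pp. 397–398, (3.49) p. 399, Thm 3.12 p. 423, Thm 3.13 p. 426 + (3.152)–(3.153) p. 426; [4] (2.51)–(2.56) pp. 232–233, Lemma 2.1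
(2.60)–(2.61) p. 234.

WHY THIS FILE (cell `pub-ymgap`, node N06, seat dag-n06-l g22; sequel of `B9Thm313WholeCutLettersSupFrom344` (g19), `B9SmoothHolderClassTReadings` (g21),
`B9SmoothHolderClassTClosure` + `B9Thm313WholeCutLettersGXHAtPinsT` (g22)).  The certificate displays, on the FREE bond class `bXH`, the record
`hletters13 : Letters313Zc … (bXH x) U` (ten letters; two read `bXH`: `gXH`, `wGp`) and the probe letter `hWE` (= `Letters313HZc.pWE`).  g19 reduced `wGp ∕ pWE` to
print's (3.44) ∕ (3.45) ∕ (3.43)₁ for G′ at the class plus the class embedding `hX`; g22 reduced `gXH` to G₀ material plus the closure.  AT THE GRADED TRANSPORTED PIN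
both class axioms are THEOREMS (`hasMaj_id_bHZKG_cNorm`, `hXcl_bHZKT`), so:
* §1 ★★ `wGp_bHZKG_of_pins` — `Letters313Zc.wGp` at `bXH := bHZKG i b g 1 w` from (3.44) for G′ read at ONE transported member `bHZKT g s 1` (`0 < s < 1`, `0 < w s`),
  `Thm31GpMaj`, `Proj349Maj`, `R = ϱ•(I − P)`, member facts, the pin `𝔬.blk = blkBK bI` and the carrier binders — NO class axiom;
* §2 ★★ `pWE_bHZKG_of_pins` — the certificate's `hWE` (`Letters313HZc.pWE β`) likewise from (3.45) for G′ at `bHZKT g s 1` and the (3.43)₁ probe of ∇G′;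
* §3 ★★ `letters313Zc_bHZKG_of_pins` — THE WHOLE RECORD `Letters313Zc … (bHZKG g 1 w) U` from the `bXH`-free record `Letters313Z` (`B9Thm313WholeZ`), §1 and
  `B9Thm313WholeCutLettersGXHAtPinsT.gXH_bHZKG_of_pins` (`Letters313Zc.of_Z`): at the option-(2) pin the displayed `hletters13` REDUCES to `Letters313Z` + (3.44) for G′
  at the transported class + (3.42)₃ ∕ ∀s (3.43)₂ for G₀ + the steps + `Identities` + pins.
HONEST SCOPE.  Kernel bookkeeping over landed schemas and engines; NOTHING of print's estimates is asserted — every (3.4x) member, step and identity is a HYPOTHESIS of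
printed species; no certificate edit; COUNT-NEUTRAL; N06 NOT discharged; one finite lattice at a time; nothing continuum, nothing about the mass gap ∕ Clay.
Cell `pub-ymgap` (HUMAN RULING D-0062), Track A node N06 [B9], bundle F7 rows 20–21, seat `pub-ymgap-dag-n06-l` (g22), 2026-08-28.  NEW file.
-/

namespace Literature.MathematicalPhysics.QuantumFieldTheory.Balaban1983to89.B9Thm313WholeCutLettersAtPinsT

open Finset B6RandomWalk B6RandomWalkHom B9Thm34Ext B11SectG B9SectDSup B9SectDL2Decay B9Thm37Glue B9Thm312Whole
open B9Thm312WholeClasses B9RWSums343to347Whole B9RWSums343Holder B9PerturbationMajorantAlgebra B9PerturbationMajorantLetters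
open B9Thm313WholeRgdFrom3152 B9Thm312WholeLeaf B9Thm312WholeHolder B9Thm313WholeHolder B9Thm313Whole B9Thm313WholeZ B9Thm313WholeLettersCut
open B9Thm313WholeCutLettersSupFrom344 B9Thm313WholeCutLettersGXHAtPinsT
open B6GlobalChartV1 (PV blkV1)
open B6Ineq2142KLevelV1 (β lvl)
open B6KLevelCensusIndexV1 (KIdx)
open B6Geom246MultiLevelTorus (geomT)
open B9GeoNormsKLevelV1 (geo9K)
open B9CoReadingCoords (XBK blkBK)
open B9CoReadingCoordsHolder (PK blkPK probeK wK w₀K)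
open B9CoReadingCoordsHolderAdm (wKA)
open B9MultiscaleSmoothPartitionYNear (rNear dist_sIK_le_of_nearY)
open B9SmoothHolderClassT (bHZKT)
open B9SmoothHolderClassGraded (bHZKG hasMaj_from_bHZKG)
open B9SmoothHolderClassTReadings (hasMaj_id_bHZKG_cNorm)
open B9SmoothHolderClassTClosure (abs_cf_eq_nKT)
open Node00 (SiteY FBondY IBondY toKT)

noncomputable section

variable {d ℓ : ℕ} {hd : 1 ≤ d + 1} {hL : Odd (ℓ + 1) ∧ 1 < ℓ + 1} {b₀ b₁ : ℝ}
variable {𝔸 : Type} [NormedRing 𝔸] [NormedAlgebra ℂ 𝔸]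
variable {κ : Type} [Fintype κ]
variable (i : KIdx d ℓ hd hL b₀ b₁) [Fintype (geo9K i).Site] (b : Module.Basis κ ℝ 𝔸) (g : FBondY i → FBondY i → 𝔸ˣ)
variable {B : B9.Backgrounds} {Y Z W PY : Type} [Fintype Y] [Fintype Z] [Fintype W]
variable {R₀ : ℝ} {H₀ : Prop}

/-! ## §0 The class embedding at the pin, read on the ops' block map -/

/-- the embedding `bHZKG g 1 w → 𝔠⁽¹⁾` at exponent `s` on the ops' block map (`𝔬.blk = blkBK bI`), radius by LAYER B, units by `hcfk`: constant
`(w s)⁻¹·L·e^{δ(r_near+1)}` at any rate `δ ≥ 0`. [cite: Balaban1985BackgroundPropagators, (3.41)–(3.42) p.397 + (3.44) p.398; Balaban1984PropagatorsII, (2.51)–(2.54) pp.232–233] -/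
theorem hX_bHZKG_blk (hG : GeoOK (geo9K i)) (w : ℝ → ℝ) (hw0 : ∀ s, 0 ≤ w s) (hw1 : ∀ s, w s ≤ 1) {s : ℝ} (hs0 : 0 < s) (hs1 : s < 1) (hws : 0 < w s)
    {bI : FBondY i → IBondY i}
    (hβ1 : ∀ f : FBondY i, (geomT i.D).dist (β i.hN i.D i.hk (bI f)) (blkV1 i.hN i.D f) ≤ 1)
    (hlev : ∀ f : FBondY i, lvl i.hN i.D i.hk (bI f) = (blkV1 i.hN i.D f).1.1) (hbI0 : ∀ f : FBondY i, bI f = bI ⟨f.src, 0⟩)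
    (hcfk : i.cf = (((ℓ + 1 : ℕ) : ℝ)) ^ i.k) {blk : XBK κ i → IBondY i} (hblk : blk = blkBK i bI) {δ : ℝ} (hδ : 0 ≤ δ) :
    HasMaj (bHZKG (κ := κ) i b g (R := R₀) (H := H₀) le_rfl w hw0 hw1) (cNorm R₀ H₀ blk hG.lenle 1) LinearMap.id
      (fun y y' => (w s)⁻¹ * ((((ℓ + 1 : ℕ) : ℝ)) * Real.exp (δ * (rNear d ℓ + 1))) * Real.exp (-(δ * (geo9K i).dist y y'))) := by
  subst hblk
  exact (hasMaj_id_bHZKG_cNorm i b g le_rfl w hw0 hw1 hs0 hs1 hws hG.lenle hlev hbI0 hδ (fun _ _ h => dist_sIK_le_of_nearY i hβ1 h)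
    (le_of_eq (abs_cf_eq_nKT i hcfk))).mono fun y y' => le_of_eq (by ring)

/-! ## §1 ★★ `Letters313Zc.wGp` at the graded transported pin -/

omit [Fintype Y] [Fintype Z] in
/-- ★★ **`Letters313Zc.wGp` (D·G′·R·D\* : `bXH` → 𝔠⁽¹⁾) AT THE PIN `bXH := bHZKG g 1 w`** — g19's `wGp_of_h44Gp` with its class embedding `hX` DISCHARGED
(`hasMaj_id_bHZKG_cNorm`, κ_X := `(w s)⁻¹·L·e^{(δ−αδ−σ)(r_near+1)}`) and the (3.44) member for G′ read at ONE transported exponent-`s` member `bHZKT g s 1` and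
projected (`(w s)⁻¹`): any `B₃ ≥ ϱ((w s)⁻¹B₄₄ + B₀·C_P·L₀·κ_X·c²)`, `δ₃ ≤ δ − αδ − 2σ`.  NO class axiom. [cite: Balaban1985BackgroundPropagators, Thm 3.13 p.426 + (3.44) p.398 + Thm 3.1 (3.42) p.397 + (3.49) p.399 + (3.152)–(3.153) p.426; Balaban1984PropagatorsII, (2.51)–(2.56) pp.232–233 + Lemma 2.1 (2.60)–(2.61) p.234] -/
theorem wGp_bHZKG_of_pins (hG : GeoOK (geo9K i)) {dF : ℕ} {δ α L₀ σ c : ℝ} (hF : Facts347 (geo9K i) R₀ H₀ dF δ α L₀)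
    (hrow : RowSum (toB6 (geo9K i) R₀ H₀) σ c) {𝔬 : Ops (geo9K i) B (XBK κ i) Y Z W} {Gp P : B.Cfg → Module.End ℝ (W → ℝ)} {U : B.Cfg}
    (w : ℝ → ℝ) (hw0 : ∀ s, 0 ≤ w s) (hw1 : ∀ s, w s ≤ 1) {s : ℝ} (hs0 : 0 < s) (hs1 : s < 1) (hws : 0 < w s)
    {bI : FBondY i → IBondY i}
    (hβ1 : ∀ f : FBondY i, (geomT i.D).dist (β i.hN i.D i.hk (bI f)) (blkV1 i.hN i.D f) ≤ 1)
    (hlev : ∀ f : FBondY i, lvl i.hN i.D i.hk (bI f) = (blkV1 i.hN i.D f).1.1) (hbI0 : ∀ f : FBondY i, bI f = bI ⟨f.src, 0⟩)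
    (hcfk : i.cf = (((ℓ + 1 : ℕ) : ℝ)) ^ i.k) (hblk : 𝔬.blk = blkBK i bI)
    {B₀ δ₀ CP δP B44 δ44 ϱ B₃ δ₃ : ℝ}
    (h31 : Thm31GpMaj 𝔬.blkW 𝔬.blk (Gp U) (𝔬.Dv U) (𝔬.Dvstar U) R₀ H₀ B₀ δ₀)
    (h49 : Proj349Maj 𝔬.blkW 𝔬.blk (P U) (𝔬.Dv U) (𝔬.Dvstar U) R₀ H₀ CP δP)
    (hR : 𝔬.R U = ϱ • (LinearMap.id - P U))
    (h44 : HasMaj (bHZKT (κ := κ) i b g (R := R₀) (H := H₀) hs0.le hs1.le hs1.le) (cNorm R₀ H₀ 𝔬.blk hG.lenle 1) (𝔬.Dv U ∘ₗ Gp U ∘ₗ 𝔬.Dvstar U)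
      (fun a b => B44 * Real.exp (-(δ44 * (geo9K i).dist a b))))
    (hϱ : 0 ≤ ϱ) (hB₀ : 0 ≤ B₀) (hCP : 0 ≤ CP) (hB44 : 0 ≤ B44) (hc : 0 ≤ c) (hσ : 0 ≤ σ) (hαδ : 0 ≤ α * δ)
    (hδ₀ : δ ≤ δ₀) (hδP : δ ≤ δP) (hbud : 0 ≤ δ - α * δ - 2 * σ) (hδ44 : δ - α * δ - 2 * σ ≤ δ44)
    (hB₃ : ϱ * ((w s)⁻¹ * B44 + B₀ * (CP * L₀) * ((w s)⁻¹ * ((((ℓ + 1 : ℕ) : ℝ)) * Real.exp ((δ - α * δ - σ) * (rNear d ℓ + 1)))) * c * c) ≤ B₃)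
    (hδ₃ : δ₃ ≤ δ - α * δ - 2 * σ) :
    HasMaj (bHZKG (κ := κ) i b g (R := R₀) (H := H₀) le_rfl w hw0 hw1) (cNorm R₀ H₀ 𝔬.blk hG.lenle 1) (𝔬.Dv U ∘ₗ Gp U ∘ₗ 𝔬.R U ∘ₗ 𝔬.Dvstar U)
      (fun a b => B₃ * Real.exp (-(δ₃ * (geo9K i).dist a b))) := by
  have hws' : 0 ≤ (w s)⁻¹ := inv_nonneg.2 (hw0 s)
  have hρ₁ : 0 ≤ δ - α * δ - σ := by linarith
  have hX := hX_bHZKG_blk i b g (R₀ := R₀) (H₀ := H₀) hG w hw0 hw1 hs0 hs1 hws hβ1 hlev hbI0 hcfk hblk hρ₁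
  have h44' : HasMaj (bHZKG (κ := κ) i b g (R := R₀) (H := H₀) le_rfl w hw0 hw1) (cNorm R₀ H₀ 𝔬.blk hG.lenle 1) (𝔬.Dv U ∘ₗ Gp U ∘ₗ 𝔬.Dvstar U)
      (fun a b => (w s)⁻¹ * B44 * Real.exp (-(δ44 * (geo9K i).dist a b))) :=
    (hasMaj_from_bHZKG i b le_rfl w hw0 hw1 g hs0 hs1 hws (fun _ _ => mul_nonneg hB44 (Real.exp_nonneg _)) h44).mono
      fun a b => le_of_eq (by ring)
  exact wGp_of_h44Gp hG hF hrow h31 h49 hR hX h44' hϱ hB₀ hCP (by positivity) (mul_nonneg hws' hB44) hc hσ hαδ hδ₀ hδP hbud le_rfl hδ44 hB₃ hδ₃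

/-! ## §2 ★★ The probe letter `pWE` (the certificate's `hWE`) at the graded transported pin -/

omit [Fintype Y] [Fintype Z] in
/-- ★★ **`Letters313HZc.pWE β` (Φ^X_β∘(D·G′·R·D\*) : `bXH` → 𝔠_P^{(β−1)}) AT THE PIN `bXH := bHZKG g 1 w`** — g19's `pWE_of_p45Gp` with `hX` DISCHARGED and the (3.45)
member for G′ read at ONE transported member `bHZKT g s 1` (print: `s > β`, (3.45) «‖λ‖_(β+ε)»; the knit picks `s = sch β`) and projected: any
`Bx ≥ ϱ((w s)⁻¹B₄₅ + B_h·C_P·L₀·κ_X·c²)`, `δ₃ ≤ δ − αδ − 2σ`.  NO class axiom.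
[cite: Balaban1985BackgroundPropagators, Thm 3.13 p.426 + (3.43)–(3.45) p.398 + (3.49) p.399 + (3.152)–(3.153) p.426; Balaban1984PropagatorsII, (2.51)–(2.56) pp.232–233 + Lemma 2.1 (2.60)–(2.61) p.234] -/
theorem pWE_bHZKG_of_pins (hG : GeoOK (geo9K i)) {dF : ℕ} {δ α L₀ σ c : ℝ} (hF : Facts347 (geo9K i) R₀ H₀ dF δ α L₀)
    (hrow : RowSum (toB6 (geo9K i) R₀ H₀) σ c) {𝔬 : Ops (geo9K i) B (XBK κ i) Y Z W} {PX : Type} [Fintype PX]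
    (𝔭 : HolderProbes (geo9K i) B (XBK κ i) Y PX PY) {Gp P : B.Cfg → Module.End ℝ (W → ℝ)} {U : B.Cfg}
    (w : ℝ → ℝ) (hw0 : ∀ s, 0 ≤ w s) (hw1 : ∀ s, w s ≤ 1) {s : ℝ} (hs0 : 0 < s) (hs1 : s < 1) (hws : 0 < w s)
    {bI : FBondY i → IBondY i}
    (hβ1 : ∀ f : FBondY i, (geomT i.D).dist (β i.hN i.D i.hk (bI f)) (blkV1 i.hN i.D f) ≤ 1)
    (hlev : ∀ f : FBondY i, lvl i.hN i.D i.hk (bI f) = (blkV1 i.hN i.D f).1.1) (hbI0 : ∀ f : FBondY i, bI f = bI ⟨f.src, 0⟩)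
    (hcfk : i.cf = (((ℓ + 1 : ℕ) : ℝ)) ^ i.k) (hblk : 𝔬.blk = blkBK i bI)
    {CP δP B45 δ45 Bh δh ϱ Bx δ₃ βH : ℝ}
    (h49 : Proj349Maj 𝔬.blkW 𝔬.blk (P U) (𝔬.Dv U) (𝔬.Dvstar U) R₀ H₀ CP δP)
    (hR : 𝔬.R U = ϱ • (LinearMap.id - P U))
    (hp45 : HasMaj (bHZKT (κ := κ) i b g (R := R₀) (H := H₀) hs0.le hs1.le hs1.le) (cNormR R₀ H₀ 𝔭.blkPX hG.lenle (βH - 1))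
      (𝔭.ΦX U βH ∘ₗ (𝔬.Dv U ∘ₗ Gp U ∘ₗ 𝔬.Dvstar U)) (fun a b => B45 * Real.exp (-(δ45 * (geo9K i).dist a b))))
    (hpDG : HasMaj (cNormR R₀ H₀ 𝔬.blkW hG.lenle 0) (cNormR R₀ H₀ 𝔭.blkPX hG.lenle (βH - 1)) (𝔭.ΦX U βH ∘ₗ 𝔬.Dv U ∘ₗ Gp U)
      (fun a b => Bh * Real.exp (-(δh * (geo9K i).dist a b))))
    (hϱ : 0 ≤ ϱ) (hCP : 0 ≤ CP) (hB45 : 0 ≤ B45) (hBh : 0 ≤ Bh) (hc : 0 ≤ c) (hσ : 0 ≤ σ)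
    (hδP : δ ≤ δP) (hbud : 0 ≤ δ - α * δ - 2 * σ) (hδ45 : δ - α * δ - 2 * σ ≤ δ45) (hδh : δ - α * δ - σ ≤ δh)
    (hBx : ϱ * ((w s)⁻¹ * B45 + Bh * (CP * L₀) * ((w s)⁻¹ * ((((ℓ + 1 : ℕ) : ℝ)) * Real.exp ((δ - α * δ - σ) * (rNear d ℓ + 1)))) * c * c) ≤ Bx)
    (hδ₃ : δ₃ ≤ δ - α * δ - 2 * σ) :
    HasMaj (bHZKG (κ := κ) i b g (R := R₀) (H := H₀) le_rfl w hw0 hw1) (cNormR R₀ H₀ 𝔭.blkPX hG.lenle (βH - 1))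
      (𝔭.ΦX U βH ∘ₗ (𝔬.Dv U ∘ₗ Gp U ∘ₗ 𝔬.R U ∘ₗ 𝔬.Dvstar U)) (fun a b => Bx * Real.exp (-(δ₃ * (geo9K i).dist a b))) := by
  have hws' : 0 ≤ (w s)⁻¹ := inv_nonneg.2 (hw0 s)
  have hρ₁ : 0 ≤ δ - α * δ - σ := by linarith
  have hX := hX_bHZKG_blk i b g (R₀ := R₀) (H₀ := H₀) hG w hw0 hw1 hs0 hs1 hws hβ1 hlev hbI0 hcfk hblk hρ₁
  have hp45' : HasMaj (bHZKG (κ := κ) i b g (R := R₀) (H := H₀) le_rfl w hw0 hw1) (cNormR R₀ H₀ 𝔭.blkPX hG.lenle (βH - 1))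
      (𝔭.ΦX U βH ∘ₗ (𝔬.Dv U ∘ₗ Gp U ∘ₗ 𝔬.Dvstar U)) (fun a b => (w s)⁻¹ * B45 * Real.exp (-(δ45 * (geo9K i).dist a b))) :=
    (hasMaj_from_bHZKG i b le_rfl w hw0 hw1 g hs0 hs1 hws (fun _ _ => mul_nonneg hB45 (Real.exp_nonneg _)) hp45).mono
      fun a b => le_of_eq (by ring)
  exact pWE_of_p45Gp hG hF hrow 𝔭 h49 hR hX hp45' hpDG hϱ hCP (by positivity) (mul_nonneg hws' hB45) hBh hc hσ hδP hbud le_rfl hδ45 hδh hBx hδ₃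

/-! ## §3 ★★ The whole record `Letters313Zc` at the graded transported pin -/

/-- ★★ **THE RE-CUT RECORD `Letters313Zc` AT THE PIN `bXH := bHZKG g 1 w` FROM THE `bXH`-FREE RECORD `Letters313Z` AND PRINTED-SPECIES MEMBERS** (`Letters313Zc.of_Z`
with `gXH := gXH_bHZKG_of_pins`, `wGp := wGp_bHZKG_of_pins`): the certificate's displayed `hletters13` at the option-(2) pin reduces to `Letters313Z` + (3.44) for G′ at
`bHZKT g s 1` + (3.42)₃ `he2` ∕ ∀s (3.43)₂ `h43 s` for G₀ + the steps `hK ∕ hpX s` + `Identities` + the pin equations; the record's constants `B₃ δ₃` must dominate both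
derived members (`hB₃w hB₃g hδ₃w hδ₃g`). [cite: Balaban1985BackgroundPropagators, Thm 3.13 p.426 + Thm 3.12 p.423 + (3.42)–(3.45) pp.397–398 + (3.49) p.399 + (3.152)–(3.153) p.426; Balaban1984PropagatorsII, (2.51)–(2.56) pp.232–233 + Lemma 2.1 (2.60)–(2.61) p.234] -/
theorem letters313Zc_bHZKG_of_pins (hG : GeoOK (geo9K i)) {dF : ℕ} {δ α L₀ σ c : ℝ} (hF : Facts347 (geo9K i) R₀ H₀ dF δ α L₀)
    (hrow : RowSum (toB6 (geo9K i) R₀ H₀) σ c) {𝔬 : Ops (geo9K i) B (XBK κ i) Y Z W}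
    (𝔭 : HolderProbes (geo9K i) B (XBK κ i) Y (PK (FBondY i) (Fin (d + 1)) κ) PY) {Gp P : B.Cfg → Module.End ℝ (W → ℝ)} {U : B.Cfg}
    {wZ : (geo9K i).Site → ℝ} {hwZ : ∀ y, 0 < wZ y} {B₃ δ₃ : ℝ} (hL : Letters313Z 𝔬 R₀ H₀ hG wZ hwZ B₃ δ₃ U)
    (w : ℝ → ℝ) (hw0 : ∀ s, 0 ≤ w s) (hw1 : ∀ s, w s ≤ 1) {s : ℝ} (hs0 : 0 < s) (hs1 : s < 1) (hws : 0 < w s)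
    {bI : FBondY i → IBondY i}
    (hβ1 : ∀ f : FBondY i, (geomT i.D).dist (β i.hN i.D i.hk (bI f)) (blkV1 i.hN i.D f) ≤ 1)
    (hlev : ∀ f : FBondY i, lvl i.hN i.D i.hk (bI f) = (blkV1 i.hN i.D f).1.1) (hbI0 : ∀ f : FBondY i, bI f = bI ⟨f.src, 0⟩)
    (hcfk : i.cf = (((ℓ + 1 : ℕ) : ℝ)) ^ i.k) (hblk : 𝔬.blk = blkBK i bI) (hPX : 𝔭.blkPX = blkPK bI)
    (hΦ : ∀ s, 0 < s → s < 1 → 𝔭.ΦX U s = probeK b g (wKA i s) (w₀K i s))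
    -- the `wGp` data ((3.44) for G′ at the transported member, Thm 3.1, (3.49), R = ϱ(I − P))
    {B₀ δ₀ CP δP B44 δ44 ϱ : ℝ}
    (h31 : Thm31GpMaj 𝔬.blkW 𝔬.blk (Gp U) (𝔬.Dv U) (𝔬.Dvstar U) R₀ H₀ B₀ δ₀)
    (h49 : Proj349Maj 𝔬.blkW 𝔬.blk (P U) (𝔬.Dv U) (𝔬.Dvstar U) R₀ H₀ CP δP)
    (hR : 𝔬.R U = ϱ • (LinearMap.id - P U))
    (h44 : HasMaj (bHZKT (κ := κ) i b g (R := R₀) (H := H₀) hs0.le hs1.le hs1.le) (cNorm R₀ H₀ 𝔬.blk hG.lenle 1) (𝔬.Dv U ∘ₗ Gp U ∘ₗ 𝔬.Dvstar U)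
      (fun a b => B44 * Real.exp (-(δ44 * (geo9K i).dist a b))))
    (hϱ : 0 ≤ ϱ) (hB₀ : 0 ≤ B₀) (hCP : 0 ≤ CP) (hB44 : 0 ≤ B44) (hc : 0 ≤ c) (hσ : 0 ≤ σ) (hαδ : 0 ≤ α * δ)
    (hδ₀ : δ ≤ δ₀) (hδP : δ ≤ δP) (hbud : 0 ≤ δ - α * δ - 2 * σ) (hδ44 : δ - α * δ - 2 * σ ≤ δ44)
    (hB₃w : ϱ * ((w s)⁻¹ * B44 + B₀ * (CP * L₀) * ((w s)⁻¹ * ((((ℓ + 1 : ℕ) : ℝ)) * Real.exp ((δ - α * δ - σ) * (rNear d ℓ + 1)))) * c * c) ≤ B₃)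
    (hδ₃w : δ₃ ≤ δ - α * δ - 2 * σ)
    -- the `gXH` data ((3.42)₃ and ∀s (3.43)₂ for G₀, the steps, the identities)
    {θ B₀' δ₀' δK ρ BH : ℝ} {θH Bh : ℝ → ℝ}
    (hθ : 0 ≤ θ) (hθH : ∀ s, 0 < s → s < 1 → 0 ≤ θH s) (hB₀' : 0 ≤ B₀') (hBh : ∀ s, 0 < s → s < 1 → 0 ≤ Bh s) (hBH : 0 ≤ BH)
    (hρ : 0 ≤ ρ) (hρS : ρ ≤ δ₀') (hρδ : ρ + σ ≤ δK) (hq : θ * c < 1)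
    (hwB : ∀ s, 0 < s → s < 1 → w s * (Bh s + θH s * (B₀' * (1 - θ * c)⁻¹) * c) ≤ BH)
    (hK : HasMaj (cNorm R₀ H₀ 𝔬.blk hG.lenle 1) (cNorm R₀ H₀ 𝔬.blk hG.lenle 1) (𝔬.G0 U ∘ₗ (𝔬.Tpi U + 𝔬.T2 U))
      (fun a b => θ * Real.exp (-(δK * (geo9K i).dist a b))))
    (he2 : HasMajorantHom (g := toB6 (geo9K i) R₀ H₀) 𝔬.blkY 𝔬.blk (𝔬.G0 U ∘ₗ 𝔬.Dstar U)
      (fun a b => B₀' * (geo9K i).len a * Real.exp (-(δ₀' * (geo9K i).dist a b))))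
    (h43 : ∀ s, 0 < s → s < 1 → HasMajorantHom (g := toB6 (geo9K i) R₀ H₀) 𝔬.blkY 𝔭.blkPX (𝔭.ΦX U s ∘ₗ (𝔬.G0 U ∘ₗ 𝔬.Dstar U))
      (fun (a b : (geo9K i).Site) => Bh s * (geo9K i).len a ^ (1 - s) * Real.exp (-(δ₀' * (geo9K i).dist a b))))
    (hpX : ∀ s, 0 < s → s < 1 → HasMaj (cNormR R₀ H₀ 𝔬.blk hG.lenle (-1)) (cNormR R₀ H₀ 𝔭.blkPX hG.lenle (s - 1))
      ((𝔭.ΦX U s ∘ₗ 𝔬.G0 U) ∘ₗ (𝔬.Tpi U + 𝔬.T2 U)) (fun a b => θH s * Real.exp (-(δK * (geo9K i).dist a b))))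
    (hI : Identities 𝔬 U)
    (hB₃g : (((ℓ + 1 : ℕ) : ℝ)) * Real.exp (ρ * (rNear d ℓ + 1)) * (B₀' * (1 - θ * c)⁻¹ + BH) ≤ B₃) (hδ₃g : δ₃ ≤ ρ) :
    Letters313Zc 𝔬 Gp R₀ H₀ hG wZ hwZ B₃ δ₃ (bHZKG (κ := κ) i b g (R := R₀) (H := H₀) le_rfl w hw0 hw1) U :=
  Letters313Zc.of_Z hL
    (gXH_bHZKG_of_pins i b g hG hrow 𝔭 w hw0 hw1 hc hθ hθH hB₀' hBh hBH hρ hρS hρδ hq hwB hβ1 hlev hbI0 hcfk hblk hPX hΦ hK he2 h43 hpX hI hB₃g hδ₃g)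
    (wGp_bHZKG_of_pins i b g hG hF hrow w hw0 hw1 hs0 hs1 hws hβ1 hlev hbI0 hcfk hblk h31 h49 hR h44 hϱ hB₀ hCP hB44 hc hσ hαδ hδ₀ hδP hbud hδ44 hB₃w hδ₃w)

end

end Literature.MathematicalPhysics.QuantumFieldTheory.Balaban1983to89.B9Thm313WholeCutLettersAtPinsT
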